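import Summits.CriticalPhenomena.PercolationContinuityZ3.Theorems.FK.Transplant.KNFreeSlabFrames
import HarnessLib

/-!
# FRONTIER TRANSPLANT, binder 2 (TP_FK) — T4-SLAB (L8): case lemma Y-COLUMN (inner, gate column of the flat direction, then the
# face box) and the arithmetic of case X (thin in the contact direction: the look box exits through the OPPOSITE face)

Support file (`--supports stmt-CriticalPhenomena-4575`, helper) of the FRONTIER TRANSPLANT sub-cell (`fk-continuity/transplant/`,
seat `prim-bschramm-fkt-p1`); builds on p205010 (kernel theorem, internal audit signed; external expert review pending).
0 definitions · 0 named facts · 0 sorries · standard axioms. File 10/18 of the bytes-first package (R60 (3)(β)) of the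
UNFUNDED memo row `T4-SLAB [g122, R60]` (re-described R62 (E)); proposable only on a coordinator ruling.
Registered R63 (cell INBOX l.4709, 2026-08-23); registry row T4s; lead label T4s-10 (fkt-lead L22, l.4677).

HONEST FRAMING (page 1, cell rule). The transplant's theorem of record `ufsc0_of_freeBoundaryHypothesis_r3` (p248245) is
CONDITIONAL on FH AND on TP_FK = `KNFreeTargetHittable d q p`, both OPEN at the same `p` for `q > 1` near `p_c(q)` (⇔ GRC Conj.
(5.103) via K1; barrier note `Literature.Barriers.CriticalPhenomena.SamePFreeBoundaryCriteria`, FBN-01, cited first); the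
transplant is a typed reduction, not a proof of FK continuity. THIS FILE: case lemma `lane_caseYcol` (inner contact, `F` flat in a direction `a ≠ i` at a face of `Q` lying beyond
the level box's collar: route IC-B through a gate column of direction `a`), the thin-direction frame `inner_frame_X`,
and the arithmetic of case X (`caseX_i_facts`, `exists_interior_unit`, `X_wf_facts`: the level box is thin in the
contact direction `i`, the look box sticks out through the face opposite to the contact, gate column of direction
`i`). It proves nothing about either binder and says nothing at `p ↓ p_c(q)`; NOT `_r4`; `_r3` « 2 / 0 ☑ », n_open = 2,
BINDER-OWNERS, FO-19 NO-GO unchanged.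

Declarations: `lane_caseYcol`, `inner_frame_X`, `caseX_i_facts`, `exists_interior_unit`, `X_wf_facts`.

References: G. Grimmett, *The Random-Cluster Model*, Springer 2006, Thm. (3.1) eq. (3.4), Thm. (3.7), Thm. (3.8), Thm. (3.21)
eq. (3.22), Lemma (4.13), §5.7 [Grimmett2006]; G. Kozma, S. Nitzan, arXiv:2401.12397 (2024), §4 Lemma 10 Step IV (pp. 19–21) [KozmaNitzan2024].
-/

noncomputable section

namespace Summit.CriticalPhenomena.PercolationContinuityZ3.Theorems.FK

open MeasureTheory
open scoped ENNReal Classical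
open Literature.Probability.Percolation Literature.Probability.LatticeModels SimpleGraph
open Literature.Probability.Percolation.GadgetSystem Literature.Probability.Percolation.KozmaNitzan Transplant
open Literature.Barriers.CriticalPhenomena

variable {d : ℕ}

/-- **Case Y-column (inner, gate column through the face `(a, τa)` of the flat direction): the level box is fat in
every direction `b ≠ c` and `F`'s flat coordinate `c_a = v_a + ℓ·loF_a` lies at or beyond the column's foot level
`ya - τa(T+1)`** (`s := τa(c_a - ya) + T + 1 ≥ 1`; for `a = i` the column face is the face opposite to the contact).
Exit on layer `T`; interior slab box to the gate foot `wf` (requested next to `v` inside `F`'s ranges); then the gate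
column — ending ON the column when `s ≤ T + 2L + 4` (route IC-A), else continuing through the face box beyond
`(a, τa)` (route IC-B); target `t = (a ↦ c_a, b ↦ wf_b)`.
[cite: KozmaNitzan2024, §4 Lemma 10 Step IV (pp. 19–21); Grimmett2006, Thm. (3.1) eq. (3.4), Thm. (3.8), eq. (3.22), §5.7 eq. (5.102)] -/
theorem lane_caseYcol {q : ℝ} (hq : 1 ≤ q) (p : unitInterval) (hd : 3 ≤ d) {L : ℕ}
    {β : ℝ} (hβ0 : 0 ≤ β) (hβ1 : β ≤ 1)
    (hβ : ∀ (N : ℕ) (g : zdGraph d ≃g zdGraph d) (u z : Site d), u ∈ fkSlab d L N → z ∈ fkSlab d L N →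
      β ≤ (fkLaw ((fkSlab d L N).image g) (restrW (↑((fkSlab d L N).image g) : Set (Site d)) (lattW d p)) q).real
        (openConnIn (↑((fkSlab d L N).image g) : Set (Site d)) (g u) (g z)))
    (Lo Hi : Site d) (i : Fin d) (σ yi : ℤ) (hface : (σ = 1 ∧ yi = Hi i) ∨ (σ = -1 ∧ yi = Lo i))
    (M₀ M T G : ℕ) (hM₀ : M₀ + L + T + 2 ≤ M) (hGM : G ≤ M₀) (v : Site d)
    (hvi : v i = yi - σ * ((M : ℤ) + 1))
    (hvb : ∀ b, b ≠ i → Lo b + M + 1 ≤ v b ∧ v b ≤ Hi b - M - 1)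
    (S : Finset (Site d)) (hS : S ⊆ Finset.Icc (Lo + 1) (Hi - 1))
    (hSint : ∀ x ∈ S, x ∉ Finset.Icc (Lo + ((T : Site d) + 1)) (Hi - ((T : Site d) + 1)))
    (ℓ : ℕ) (g : Geom d) (hloQ : ∀ b, g.loQ b ≤ -1) (hhiQ : ∀ b, 1 ≤ g.hiQ b)
    (hFQ : ∀ b, g.loQ b ≤ g.loF b ∧ g.hiF b ≤ g.hiQ b) (hF : ∀ b, g.loF b ≤ g.hiF b)
    (a : Fin d) (hF0 : ∀ b, b ≠ a → g.loF b ≤ 0 ∧ 0 ≤ g.hiF b) (hF1 : ∀ b, b ≠ a → g.loF b + 1 ≤ g.hiF b)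
    (c : Fin d) (hci : c ≠ i) (hca : c ≠ a) (ζ : ℤ)
    (hζI : v c + ℓ * g.loF c ≤ ζ - L ∧ ζ + L ≤ v c + ℓ * g.hiF c) (hζv : |ζ - v c| ≤ M₀)
    (z : Site d) (hzi : z i = yi - σ * T) (hzc : z c = ζ) (hzv : ∀ b, b ≠ i → |z b - v b| ≤ M₀)
    (Nbig mstar : ℕ) (hLN : L ≤ Nbig) (hm3 : 4 ≤ mstar) (hℓ : (M : ℤ) + 2 * T + 2 * Nbig + 2 * L + 4 ≤ ℓ)
    (hm : ∀ b, (ℓ : ℤ) * g.hiQ b - ℓ * g.loQ b + 2 * M + 2 ≤ (mstar : ℤ) * Nbig)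
    (hfatX : ∀ b, b ≠ c → Lo b + 2 * M + 2 * T + 2 * Nbig + 4 ≤ Hi b)
    -- the column face `(a, τa)` and the case condition
    (τa ya : ℤ) (hfaceA : (τa = 1 ∧ ya = Hi a) ∨ (τa = -1 ∧ ya = Lo a)) (haiτ : a = i → τa = -σ)
    (hcol : 1 ≤ τa * (v a + ℓ * g.loF a - ya) + ((T : ℤ) + 1))
    -- gate availability on the face `(a, τa)` inside the slab
    (hgateA : ∀ r : Site d, (∀ b, b ≠ a → b ≠ c → Lo b + T + 1 ≤ r b ∧ r b + G ≤ Hi b - T - 1) →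
      ∃ wf : Site d, wf a = ya - τa * ((T : ℤ) + 1) ∧ |wf c - ζ| ≤ (L : ℤ) ∧
        (∀ b, b ≠ a → b ≠ c → r b ≤ wf b ∧ wf b ≤ r b + G) ∧
        (∀ j : ℕ, 1 ≤ j → j + 1 ≤ T → Function.update wf a (ya - τa * ((T : ℤ) + 1) + τa * j) ∉ S)) :
    ∃ t w : Site d, t ∈ g.Fset ℓ v ∧ (z = w ∨ ¬ (zdGraph d).Adj z w) ∧
      ((p : ℝ) / (p + q * (1 - p))) ^ (T + 2 * L + 5) * β ^ (d * mstar) * β ^ (d * mstar) ≤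
        (fkLaw (((g.Qset ℓ v).filter fun x => |x c - ζ| ≤ (L : ℤ)) \ (S \ {z, w}))
          (restrW (↑(((g.Qset ℓ v).filter fun x => |x c - ζ| ≤ (L : ℤ)) \ (S \ {z, w})) : Set (Site d))
            (lattW d p)) q).real
        (openConnIn (↑(((g.Qset ℓ v).filter fun x => |x c - ζ| ≤ (L : ℤ)) \ (S \ {z, w})) : Set (Site d)) z t) := by
  have hq0 : 0 < q := one_pos.trans_le hq
  have hℓ0 : (0 : ℤ) ≤ ℓ := Nat.cast_nonneg ℓ
  have hA : ∀ b, (ℓ : ℤ) * g.loQ b ≤ -ℓ := fun b => by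
    have := mul_le_mul_of_nonneg_left (hloQ b) hℓ0; linarith
  have hB : ∀ b, (ℓ : ℤ) ≤ ℓ * g.hiQ b := fun b => by
    have := mul_le_mul_of_nonneg_left (hhiQ b) hℓ0; linarith
  have hAF : ∀ b, (ℓ : ℤ) * g.loQ b ≤ ℓ * g.loF b := fun b => mul_le_mul_of_nonneg_left (hFQ b).1 hℓ0
  have hFF : ∀ b, (ℓ : ℤ) * g.loF b ≤ ℓ * g.hiF b := fun b => mul_le_mul_of_nonneg_left (hF b) hℓ0
  have hFB : ∀ b, (ℓ : ℤ) * g.hiF b ≤ ℓ * g.hiQ b := fun b => mul_le_mul_of_nonneg_left (hFQ b).2 hℓ0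
  have hM₀' : (M₀ : ℤ) + L + T + 2 ≤ M := by exact_mod_cast hM₀
  have hGM' : (G : ℤ) ≤ M₀ := by exact_mod_cast hGM
  have hL0 : (0 : ℤ) ≤ L := Nat.cast_nonneg L
  have hm1 : 1 ≤ mstar := by omega
  have hNℓ' : (Nbig : ℤ) ≤ ℓ := by linarith
  have hNℓ : Nbig ≤ ℓ := by exact_mod_cast hNℓ'
  have hτ1 : τa = 1 ∨ τa = -1 := hfaceA.elim (fun h => Or.inl h.1) (fun h => Or.inr h.1)
  -- the interior frame and the foot facts
  obtain ⟨hzQ, hfat, hslabQ, hslabIn, hx1, hx1v, hvIn⟩ := inner_frame Lo Hi i σ yi hface M₀ M T L (by omega) v hvi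
    hvb ℓ g hloQ hhiQ c hci ζ hζv z hzi hzv Nbig hℓ hfatX
  set ca : ℤ := v a + ℓ * g.loF a with hca_def
  have hcaQ : v a + ℓ * g.loQ a ≤ ca ∧ ca ≤ v a + ℓ * g.hiQ a := ⟨by linarith [hAF a], by linarith [hFF a, hFB a]⟩
  obtain ⟨hfa1, hfa2, hfaQ1, hfaQ2, hdista, hzwa⟩ := Ycol_foot_facts Lo Hi i σ yi hface M₀ M T (by omega) (by omega)
    v hvi hvb ℓ a (ℓ * g.loQ a) (ℓ * g.hiQ a) ca hcaQ (hA a) (hB a) z hzi (fun h => hzv a h) Nbig mstar (hm a)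
    (hfatX a hca.symm) τa ya hfaceA haiτ hcol
  -- the gate foot `wf`
  obtain ⟨wf, hwfa, hwfcL, hwfr, hgate⟩ := hgateA (fun b => if 1 ≤ g.hiF b then v b else v b - G) (by
    intro b _ _
    have := hvIn b
    by_cases h1 : 1 ≤ g.hiF b
    · simp only [if_pos h1]; constructor <;> linarith
    · simp only [if_neg h1]; constructor <;> linarith)
  obtain ⟨hwfb, hwfI, hdist⟩ := Ycol_wf_facts Lo Hi i σ yi M₀ M T G hGM (by omega) v hvIn ℓ g hloQ hhiQ (by linarith)
    a hF0 hF1 c z hzv hx1v Nbig mstar hm τa ya wf hwfa hfa1 hfa2 hfaQ1 hfaQ2 hdista hwfr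
  have hwfc := abs_le.1 hwfcL
  -- the second frozen vertex `w` (top of the gate) is not a neighbour of the exit `z`; the target
  set w := Function.update wf a (ya - τa) with hw
  have hzw : z = w ∨ ¬ (zdGraph d).Adj z w := by
    refine Or.inr (not_adj_of_two_le_abs a ?_)
    rw [hw, Function.update_self]; exact hzwa
  set t : Site d := Function.update wf a ca with htdef
  have htF : t ∈ g.Fset ℓ v := by
    rw [Geom.Fset, mem_Icc_iff]
    intro b
    simp only [Pi.add_apply, Pi.smul_apply, smul_eq_mul]
    by_cases hba : b = a
    · rw [hba, htdef, Function.update_self]; exact ⟨le_rfl, by linarith [hFF a]⟩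
    · rw [htdef, Function.update_of_ne hba]
      by_cases hbc : b = c
      · rw [hbc]; constructor <;> linarith [hζI.1, hζI.2, hwfc.1, hwfc.2]
      · exact ⟨(hwfb b hba hbc).2.2.1, (hwfb b hba hbc).2.2.2⟩
  refine ⟨t, w, htF, hzw, ?_⟩
  have hπ0 : 0 ≤ (p : ℝ) / (p + q * (1 - p)) := div_nonneg p.2.1 (by nlinarith [p.2.1, p.2.2, hq0])
  have hπ1 : (p : ℝ) / (p + q * (1 - p)) ≤ 1 := by
    rw [div_le_one (by nlinarith [p.2.1, p.2.2, hq0])]; nlinarith [p.2.1, p.2.2, hq0]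
  -- `s := τa (c_a - ya) + T + 1 ≥ 1`: the number of column edges up to the target level
  set s : ℤ := τa * (ca - ya) + ((T : ℤ) + 1) with hsdef
  have hend : ∀ n : ℕ, (n : ℤ) = s → ya - τa * ((T : ℤ) + 1) + τa * (n : ℤ) = ca := by
    intro n hn; rw [hn, hsdef]
    rcases hτ1 with h | h <;> rw [h] <;> ring
  rcases le_or_gt s ((T : ℤ) + 2 * L + 4) with hsA | hsB
  · -- route IC-A: the target is ON the column, `n_e = s ≤ T + 2L + 4`
    obtain ⟨ne, hne⟩ : ∃ ne : ℕ, (ne : ℤ) = s := ⟨s.toNat, Int.toNat_of_nonneg (by linarith)⟩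
    have hQend : v a + ℓ * g.loQ a ≤ ya - τa * ((T : ℤ) + 1) + τa * ne ∧
        ya - τa * ((T : ℤ) + 1) + τa * ne ≤ v a + ℓ * g.hiQ a := by rw [hend ne hne]; exact hcaQ
    have h := inner_column_route hq p hd hβ0 hβ1 hβ Lo Hi i σ yi hface T v S hS hSint ℓ g c hci z ζ hzi hzc hzQ Nbig
      mstar hLN hm1 hfat hslabQ hslabIn hx1 a hca.symm τa ya hfaceA wf hwfa hwfcL hwfI hdist hgate ne hQend
    have ht' : Function.update wf a (ya - τa * ((T : ℤ) + 1) + τa * ne) = t := by rw [hend ne hne]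
    rw [ht'] at h
    refine le_trans ?_ h
    have hne' : ne + 1 ≤ T + 2 * L + 5 := by omega
    calc ((p : ℝ) / (p + q * (1 - p))) ^ (T + 2 * L + 5) * β ^ (d * mstar) * β ^ (d * mstar)
        ≤ ((p : ℝ) / (p + q * (1 - p))) ^ (ne + 1) * β ^ (d * mstar) * 1 :=
          mul_le_mul (mul_le_mul_of_nonneg_right (pow_le_pow_of_le_one hπ0 hπ1 hne') (pow_nonneg hβ0 _))
            (pow_le_one₀ hβ0 hβ1) (pow_nonneg hβ0 _) (mul_nonneg (pow_nonneg hπ0 _) (pow_nonneg hβ0 _))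
      _ = _ := by ring
  · -- route IC-B: the target is beyond the face by `D = s - T - 2 ≥ 2L + 3`
    obtain ⟨haFQ, hbFQ, hFout, hxB, hcaF, hFlen, hdca, hsm⟩ := Ycol_faceBox_facts Lo Hi v a T (ℓ * g.loQ a)
      (ℓ * g.hiQ a) ca hcaQ τa ya hfaceA hfaQ1 hfaQ2 s hsdef (by linarith)
    obtain ⟨N₂, hLN₂, hN₂ℓ, hN₂D, hN₂m⟩ := exists_faceBox_unit L Nbig mstar ℓ hm3 hNℓ hLN (s - T - 2)
      (by linarith) (by have := hm a; linarith)
    have h := inner_column_faceBox_route hq p hd hβ0 hβ1 hβ Lo Hi i σ yi hface T v S hS hSint ℓ g hloQ hhiQ c hci z ζ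
      hzi hzc hzQ Nbig mstar hLN hm1 hfat hslabQ hslabIn hx1 a hca.symm τa ya hfaceA wf hwfa hwfcL hwfI hdist hgate
      _ _ haFQ hbFQ hFout hxB N₂ mstar (by linarith) hN₂ℓ hLN₂ t
      (by rw [htdef, Function.update_of_ne hca]; constructor <;> linarith [hwfc.1, hwfc.2])
      (by rw [htdef, Function.update_self]; exact hcaF)
      (fun b hbc hba => by
        have := hwfb b hba hbc; rw [htdef, Function.update_of_ne hba]; constructor <;> linarith [hA b, hB b])
      (fun b hbc hba => by rw [htdef, Function.update_of_ne hba, sub_self, abs_zero]; positivity)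
      (by rw [htdef, Function.update_self]; exact hdca.trans hN₂m)
      (by rw [htdef, Function.update_of_ne hca, sub_self, abs_zero]; positivity)
    refine le_trans ?_ h
    have hT' : T + 3 ≤ T + 2 * L + 5 := by omega
    exact mul_le_mul_of_nonneg_right (mul_le_mul_of_nonneg_right (pow_le_pow_of_le_one hπ0 hπ1 hT')
      (pow_nonneg hβ0 _)) (pow_nonneg hβ0 _)


/-- **Interior frame of an inner lane, level box THIN in the contact direction `i`** (case X): as `inner_frame`,
with the interior slab box `2N`-fat for the case's own unit `N ≤ Nbig` (`2N ≤` the interior `i`-width), the look box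
covering the level box in direction `i`. [folklore] -/
theorem inner_frame_X (Lo Hi : Site d) (i : Fin d) (σ yi : ℤ) (hface : (σ = 1 ∧ yi = Hi i) ∨ (σ = -1 ∧ yi = Lo i))
    (M₀ M T L : ℕ) (hM₀ : M₀ + L + T ≤ M) (v : Site d) (hvi : v i = yi - σ * ((M : ℤ) + 1))
    (hvb : ∀ b, b ≠ i → Lo b + M + 1 ≤ v b ∧ v b ≤ Hi b - M - 1)
    (ℓ : ℕ) (g : Geom d) (hloQ : ∀ b, g.loQ b ≤ -1) (hhiQ : ∀ b, 1 ≤ g.hiQ b)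
    (c : Fin d) (hci : c ≠ i) (ζ : ℤ) (hζv : |ζ - v c| ≤ M₀)
    (z : Site d) (hzi : z i = yi - σ * T) (hzv : ∀ b, b ≠ i → |z b - v b| ≤ M₀)
    (Nbig N : ℕ) (hN : N ≤ Nbig) (hℓ : (M : ℤ) + 2 * T + 2 * Nbig + 2 * L + 4 ≤ ℓ)
    (hfatX : ∀ b, b ≠ c → b ≠ i → Lo b + 2 * M + 2 * T + 2 * Nbig + 4 ≤ Hi b)
    (hWi : Lo i + 2 * T + 2 * N + 2 ≤ Hi i) (hwi : Lo i + 2 * M + 2 ≤ Hi i) (hthin : Hi i - Lo i ≤ ℓ + M) :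
    z ∈ g.Qset ℓ v ∧
    (∀ b, b ≠ c → max (Lo b + T + 1) (v b + ℓ * g.loQ b) + 2 * (N : ℤ) ≤ min (Hi b - T - 1) (v b + ℓ * g.hiQ b)) ∧
    (v c + ℓ * g.loQ c ≤ ζ - L ∧ ζ + L ≤ v c + ℓ * g.hiQ c) ∧
    (Lo c + T + 1 ≤ ζ - L ∧ ζ + L ≤ Hi c - T - 1) ∧
    (∀ b, b ≠ c → max (Lo b + T + 1) (v b + ℓ * g.loQ b) ≤ Function.update z i (yi - σ * ((T : ℤ) + 1)) b ∧
      Function.update z i (yi - σ * ((T : ℤ) + 1)) b ≤ min (Hi b - T - 1) (v b + ℓ * g.hiQ b)) ∧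
    |yi - σ * ((T : ℤ) + 1) - v i| ≤ (M : ℤ) ∧
    (∀ b, Lo b + M + 1 ≤ v b ∧ v b ≤ Hi b - M - 1) ∧
    (v i + ℓ * g.loQ i ≤ Lo i ∧ Hi i ≤ v i + ℓ * g.hiQ i) := by
  have hℓ0 : (0 : ℤ) ≤ ℓ := Nat.cast_nonneg ℓ
  have hA : ∀ b, (ℓ : ℤ) * g.loQ b ≤ -ℓ := fun b => by
    have := mul_le_mul_of_nonneg_left (hloQ b) hℓ0; linarith
  have hB : ∀ b, (ℓ : ℤ) ≤ ℓ * g.hiQ b := fun b => by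
    have := mul_le_mul_of_nonneg_left (hhiQ b) hℓ0; linarith
  have hM₀' : (M₀ : ℤ) + L + T ≤ M := by exact_mod_cast hM₀
  have hN' : (N : ℤ) ≤ Nbig := by exact_mod_cast hN
  have hL0 : (0 : ℤ) ≤ L := Nat.cast_nonneg L
  have hT0 : (0 : ℤ) ≤ T := Nat.cast_nonneg T
  have hN0 : (0 : ℤ) ≤ N := Nat.cast_nonneg N
  have hzv' : ∀ b, b ≠ i → v b - M₀ ≤ z b ∧ z b ≤ v b + M₀ := fun b hb => by
    have := hzv b hb; rw [abs_le] at this; constructor <;> linarith [this.1, this.2]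
  have hζv' : v c - M₀ ≤ ζ ∧ ζ ≤ v c + M₀ := by rw [abs_le] at hζv; constructor <;> linarith [hζv.1, hζv.2]
  have hIi : Lo i + M + 1 ≤ v i ∧ v i ≤ Hi i - M - 1 ∧ (v i + ℓ * g.loQ i ≤ Lo i ∧ Hi i ≤ v i + ℓ * g.hiQ i) ∧
      Lo i + T + 1 ≤ yi - σ * ((T : ℤ) + 1) ∧ yi - σ * ((T : ℤ) + 1) ≤ Hi i - T - 1 ∧
      |yi - σ * ((T : ℤ) + 1) - v i| ≤ (M : ℤ) := by
    rcases hface with ⟨hσ, hy⟩ | ⟨hσ, hy⟩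
    · rw [hσ, hy] at hvi ⊢; rw [hvi]
      refine ⟨by linarith, by linarith, ⟨by linarith [hA i], by linarith [hB i]⟩, by linarith, by linarith, ?_⟩
      rw [abs_le]; constructor <;> linarith
    · rw [hσ, hy] at hvi ⊢; rw [hvi]
      refine ⟨by linarith, by linarith, ⟨by linarith [hA i], by linarith [hB i]⟩, by linarith, by linarith, ?_⟩
      rw [abs_le]; constructor <;> linarith
  obtain ⟨hvi1, hvi2, hUi, hx1i1, hx1i2, hx1v⟩ := hIi
  have hvIn : ∀ b, Lo b + M + 1 ≤ v b ∧ v b ≤ Hi b - M - 1 := by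
    intro b
    by_cases hb : b = i
    · rw [hb]; exact ⟨hvi1, hvi2⟩
    · exact hvb b hb
  refine ⟨mem_Qset_of_forall fun b => ?_, fun b hbc => ?_, ⟨by linarith [hζv'.1, hA c], by linarith [hζv'.2, hB c]⟩,
    ⟨by linarith [hζv'.1, (hvb c hci).1], by linarith [hζv'.2, (hvb c hci).2]⟩, fun b hbc => ?_, hx1v, hvIn, hUi⟩
  · by_cases hb : b = i
    · rw [hb, hzi, hvi]
      rcases hface with ⟨hσ, -⟩ | ⟨hσ, -⟩ <;> rw [hσ] <;> constructor <;> linarith [hA i, hB i]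
    · constructor <;> linarith [hzv' b hb, hA b, hB b]
  · by_cases hb : b = i
    · rw [hb]; exact max_add_le_min (by linarith) (by linarith [hUi.2]) (by linarith [hUi.1]) (by linarith [hA i, hB i])
    · have hfb := hfatX b hbc hb
      have hv := hvIn b
      exact max_add_le_min (by linarith) (by linarith [hB b]) (by linarith [hA b]) (by linarith [hA b, hB b])
  · by_cases hb : b = i
    · rw [hb, Function.update_self]
      exact ⟨max_le hx1i1 (by linarith [hUi.1]), le_min hx1i2 (by linarith [hUi.2])⟩
    · rw [Function.update_of_ne hb]
      have := hvb b hb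
      exact ⟨max_le (by linarith [hzv' b hb]) (by linarith [hzv' b hb, hA b]),
        le_min (by linarith [hzv' b hb]) (by linarith [hzv' b hb, hB b])⟩

/-- **Case X arithmetic** (column through the face `(i, -σ)` opposite to the contact, face box beyond it): the foot
and target coordinates in direction `i`, the face box `[aF, bF]` beyond `(i, -σ)` and the travel inside it.
[folklore] -/
theorem caseX_i_facts (Lo Hi v : Site d) (i : Fin d) (σ yi : ℤ) (hface : (σ = 1 ∧ yi = Hi i) ∨ (σ = -1 ∧ yi = Lo i))
    (M T : ℕ) (hTM : T + 2 ≤ M) (hvi : v i = yi - σ * ((M : ℤ) + 1)) (ℓ : ℕ) (A B fl fh : ℤ) (hA : A ≤ -ℓ) (hB : (ℓ : ℤ) ≤ B)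
    (hAF : A ≤ fl) (hFF : fl ≤ fh) (hFB : fh ≤ B) (hXF : (σ = 1 → fl ≤ -ℓ) ∧ (σ = -1 → (ℓ : ℤ) ≤ fh))
    (Nbig mstar : ℕ) (hm : B - A + 2 * M + 2 ≤ (mstar : ℤ) * Nbig) (hthin : Hi i - Lo i ≤ ℓ + M - 2 * Nbig)
    (hwi : Lo i + 2 * M + 2 ≤ Hi i) :
    let τf : ℤ := -σ
    let yf : ℤ := if σ = 1 then Lo i else Hi i
    let aF : ℤ := if σ = 1 then v i + A else Hi i + 1
    let bF : ℤ := if σ = 1 then Lo i - 1 else v i + B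
    let tI : ℤ := if σ = 1 then v i + fl else v i + fh
    ((τf = 1 ∧ yf = Hi i) ∨ (τf = -1 ∧ yf = Lo i)) ∧
    (Lo i + T + 1 ≤ yf - τf * ((T : ℤ) + 1) ∧ yf - τf * ((T : ℤ) + 1) ≤ Hi i - T - 1) ∧
    (v i + A ≤ yf - τf * ((T : ℤ) + 1) ∧ yf - τf * ((T : ℤ) + 1) ≤ v i + B) ∧
    |yi - σ * ((T : ℤ) + 1) - (yf - τf * ((T : ℤ) + 1))| ≤ Hi i - Lo i - 2 * T - 2 ∧
    2 ≤ |yi - σ * (T : ℤ) - (yf - τf)| ∧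
    v i + A ≤ aF ∧ bF ≤ v i + B ∧ (∀ w : ℤ, aF ≤ w → w ≤ bF → 0 ≤ τf * (w - yf)) ∧
    (aF ≤ yf + τf ∧ yf + τf ≤ bF) ∧ aF + 2 * (Nbig : ℤ) ≤ bF ∧
    (aF ≤ tI ∧ tI ≤ bF) ∧ (v i + fl ≤ tI ∧ tI ≤ v i + fh) ∧ |yf + τf - tI| ≤ (mstar : ℤ) * Nbig := by
  have hT0 : (0 : ℤ) ≤ T := Nat.cast_nonneg T
  have hN0 : (0 : ℤ) ≤ Nbig := Nat.cast_nonneg Nbig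
  have hTM' : (T : ℤ) + 2 ≤ M := by exact_mod_cast hTM
  rcases hface with ⟨hσ, hy⟩ | ⟨hσ, hy⟩
  · have h1 := hXF.1 hσ
    simp only [hσ, hy, if_true]
    rw [hσ, hy] at hvi; rw [hvi]
    refine ⟨by norm_num, ⟨by linarith, by linarith⟩, ⟨by linarith, by linarith⟩, ?_, ?_, le_rfl, by linarith,
      fun w _ hw => by linarith, ⟨by linarith, by linarith⟩, by linarith, ⟨by linarith, by linarith⟩, ⟨le_rfl, by linarith⟩, ?_⟩
    · rw [abs_le]; constructor <;> linarith
    · rw [le_abs]; left; linarith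
    · rw [abs_le]; constructor <;> linarith
  · have h1 := hXF.2 hσ
    simp only [hσ, hy, show (-1 : ℤ) ≠ 1 by norm_num, if_false, neg_neg]
    rw [hσ, hy] at hvi; rw [hvi]
    refine ⟨by norm_num, ⟨by linarith, by linarith⟩, ⟨by linarith, by linarith⟩, ?_, ?_, by linarith, le_rfl,
      fun w hw _ => by linarith, ⟨by linarith, by linarith⟩, by linarith, ⟨by linarith, by linarith⟩, ⟨by linarith, le_rfl⟩, ?_⟩
    · rw [abs_le]; constructor <;> linarith
    · rw [le_abs]; right; linarith
    · rw [abs_le]; constructor <;> linarith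


/-- Fatness unit for the interior leg of case X: `N = Nbig` if the interior `i`-width `W` is at least `2·Nbig`, else
`⌊W/2⌋`; in both cases `2N ≤ W ≤ mstar·N` and the transverse reach `M₀ + G ≤ mstar·N`. [folklore] -/
theorem exists_interior_unit (L Nbig mstar M₀ G : ℕ) (W : ℤ) (hm3 : 4 ≤ mstar) (hLN : L ≤ Nbig)
    (hW : 2 * ((M₀ : ℤ) + G) + 2 * L + 2 ≤ W) (hWm : W ≤ (mstar : ℤ) * Nbig) :
    ∃ N : ℕ, L ≤ N ∧ N ≤ Nbig ∧ 2 * (N : ℤ) ≤ W ∧ W ≤ (mstar : ℤ) * N ∧ (M₀ : ℤ) + G ≤ (mstar : ℤ) * N := by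
  have hm3' : (3 : ℤ) ≤ mstar := by have : (4 : ℤ) ≤ mstar := (by exact_mod_cast hm3); linarith
  have hL0 : (0 : ℤ) ≤ L := Nat.cast_nonneg L
  have hMG0 : (0 : ℤ) ≤ (M₀ : ℤ) + G := by positivity
  rcases le_or_gt (2 * (Nbig : ℤ)) W with h | h
  · refine ⟨Nbig, hLN, le_rfl, h, hWm, ?_⟩
    have h4 := mul_le_mul_of_nonneg_right hm3' (Nat.cast_nonneg Nbig : (0 : ℤ) ≤ Nbig)
    linarith
  · obtain ⟨K, hK⟩ : ∃ K : ℕ, (K : ℤ) = W / 2 := ⟨(W / 2).toNat, Int.toNat_of_nonneg (by omega)⟩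
    have h1 : (L : ℤ) ≤ W / 2 := by omega
    have h2 : W / 2 ≤ (Nbig : ℤ) := by omega
    have h3 : 2 * (W / 2) ≤ W := by omega
    have h4 : W ≤ 3 * (W / 2) := by omega
    have h5 : (M₀ : ℤ) + G ≤ W / 2 := by omega
    rw [← hK] at h1 h2 h3 h4 h5
    have h6 := mul_le_mul_of_nonneg_right hm3' (Nat.cast_nonneg K : (0 : ℤ) ≤ K)
    exact ⟨K, by exact_mod_cast h1, by exact_mod_cast h2, h3, by linarith, by linarith⟩

/-- **The gate foot's transverse coordinates** (case X, column in direction `i`): window `[r_b, r_b + G]` next to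
`v_b`, inside `I_b` for `b ∉ {i, c, a}`, inside the interior slab box, and within `mstar·N` of `x₁`. [folklore] -/
theorem X_wf_facts (Lo Hi : Site d) (i : Fin d) (M₀ M T G : ℕ) (hGM : G ≤ M₀) (hM₀ : M₀ + T + 2 ≤ M)
    (v : Site d) (hvIn : ∀ b, Lo b + M + 1 ≤ v b ∧ v b ≤ Hi b - M - 1)
    (ℓ : ℕ) (g : Geom d) (hloQ : ∀ b, g.loQ b ≤ -1) (hhiQ : ∀ b, 1 ≤ g.hiQ b) (hGℓ : (G : ℤ) ≤ ℓ)
    (a : Fin d) (hF0 : ∀ b, b ≠ a → g.loF b ≤ 0 ∧ 0 ≤ g.hiF b) (hF1 : ∀ b, b ≠ a → g.loF b + 1 ≤ g.hiF b)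
    (c : Fin d) (z : Site d) (hzv : ∀ b, b ≠ i → |z b - v b| ≤ M₀) (x1i : ℤ)
    (N mstar : ℕ) (hMG : (M₀ : ℤ) + G ≤ (mstar : ℤ) * N)
    (wf : Site d) (foot : ℤ) (hwfi : wf i = foot)
    (hfi1 : Lo i + T + 1 ≤ foot) (hfi2 : foot ≤ Hi i - T - 1)
    (hfiQ1 : v i + ℓ * g.loQ i ≤ foot) (hfiQ2 : foot ≤ v i + ℓ * g.hiQ i) (hdisti : |x1i - foot| ≤ (mstar : ℤ) * N)
    (hwfr : ∀ b, b ≠ i → b ≠ c →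
      (fun b => if 1 ≤ g.hiF b then v b else v b - G) b ≤ wf b ∧ wf b ≤ (fun b => if 1 ≤ g.hiF b then v b else v b - G) b + G) :
    (∀ b, b ≠ i → b ≠ c → v b - G ≤ wf b ∧ wf b ≤ v b + G) ∧
    (∀ b, b ≠ i → b ≠ c → b ≠ a → v b + ℓ * g.loF b ≤ wf b ∧ wf b ≤ v b + ℓ * g.hiF b) ∧
    (∀ b, b ≠ c → max (Lo b + T + 1) (v b + ℓ * g.loQ b) ≤ wf b ∧ wf b ≤ min (Hi b - T - 1) (v b + ℓ * g.hiQ b)) ∧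
    (∀ b, b ≠ c → |Function.update z i x1i b - wf b| ≤ (mstar : ℤ) * N) := by
  have hℓ0 : (0 : ℤ) ≤ ℓ := Nat.cast_nonneg ℓ
  have hA : ∀ b, (ℓ : ℤ) * g.loQ b ≤ -ℓ := fun b => by
    have := mul_le_mul_of_nonneg_left (hloQ b) hℓ0; linarith
  have hB : ∀ b, (ℓ : ℤ) ≤ ℓ * g.hiQ b := fun b => by
    have := mul_le_mul_of_nonneg_left (hhiQ b) hℓ0; linarith
  have hGM' : (G : ℤ) ≤ M₀ := by exact_mod_cast hGM
  have hM₀' : (M₀ : ℤ) + T + 2 ≤ M := by exact_mod_cast hM₀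
  have hG0 : (0 : ℤ) ≤ G := Nat.cast_nonneg G
  have hT0 : (0 : ℤ) ≤ T := Nat.cast_nonneg T
  have hwin : ∀ b, b ≠ i → b ≠ c → v b - G ≤ wf b ∧ wf b ≤ v b + G := by
    intro b hbi hbc
    have hw := hwfr b hbi hbc
    by_cases h1 : 1 ≤ g.hiF b
    · simp only [if_pos h1] at hw; constructor <;> linarith
    · simp only [if_neg h1] at hw; constructor <;> linarith
  refine ⟨hwin, fun b hbi hbc hba => ?_, fun b hbc => ?_, fun b hbc => ?_⟩
  · have hw := hwfr b hbi hbc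
    have hF0' : (ℓ : ℤ) * g.loF b ≤ 0 ∧ 0 ≤ (ℓ : ℤ) * g.hiF b :=
      ⟨mul_nonpos_of_nonneg_of_nonpos hℓ0 (hF0 b hba).1, mul_nonneg hℓ0 (hF0 b hba).2⟩
    by_cases h1 : 1 ≤ g.hiF b
    · simp only [if_pos h1] at hw
      have : (ℓ : ℤ) ≤ ℓ * g.hiF b := by have := mul_le_mul_of_nonneg_left h1 hℓ0; linarith
      constructor <;> linarith
    · simp only [if_neg h1] at hw
      have h2 : g.loF b ≤ -1 := by have := hF1 b hba; have := (hF0 b hba).2; omega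
      have : (ℓ : ℤ) * g.loF b ≤ -ℓ := by have := mul_le_mul_of_nonneg_left h2 hℓ0; linarith
      constructor <;> linarith
  · by_cases hbi : b = i
    · rw [hbi, hwfi]; exact ⟨max_le hfi1 hfiQ1, le_min hfi2 hfiQ2⟩
    · have hw := hwin b hbi hbc
      have hv := hvIn b
      exact ⟨max_le (by linarith) (by linarith [hA b]), le_min (by linarith) (by linarith [hB b])⟩
  · by_cases hbi : b = i
    · rw [hbi, Function.update_self, hwfi]; exact hdisti
    · rw [Function.update_of_ne hbi]
      have hw := hwin b hbi hbc
      have hz := hzv b hbi; rw [abs_le] at hz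
      rw [abs_le]; constructor <;> linarith

end Summit.CriticalPhenomena.PercolationContinuityZ3.Theorems.FK

end
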